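import Literature.AlgebraicGeometry.Frobenioids.PadicKummerRelCosetGaloisConj
import HarnessLib

/-!
# Frobenioids II, Thm. 2.4 setting p. 19: "an outer isomorphism `Π₁ ⥲ Π₂` that lies over an outer isomorphism `G₁ ⥲ G₂`" —
# the induced TOPOLOGICAL isomorphism `G₁ = Im(Π₁) ⥲ G₂ = Im(Π₂)` inside `G_{ℚ_{p₁}}`, `G_{ℚ_{p₂}}`

Mochizuki, *The geometry of Frobenioids II*, Kyushu J. Math. **62** (2008) 401–460, §2, Theorem 2.4 p. 19
[cite: MochizukiFrdII2008, Thm 2.4 (i) p.19]: "`Πᵢ → Qᵢ := G_{ℚ_{pᵢ}}` is an open homomorphism …; `Gᵢ := Im(Πᵢ) ⊆ Qᵢ` … an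
outer isomorphism of topological groups `Π₁ ⥲ Π₂` … that lies over an outer isomorphism of topological groups `G₁ ⥲ G₂`".

Definitions file (seat abc-iut-L1-t7, gen 5; binders of `thm24i_ofFunctorRel`, successor residual of GAP row G-L1t7-α).
For open homomorphisms `φᵢ : Πᵢ → G_{ℚ_{pᵢ}}` and a continuous, open, surjective homomorphism `θ : Π₁ → Π₂` "lying over" the
`G`'s — `θ` carries `Ker φ₁` exactly onto `Ker φ₂` on its image, `hkerθ : φ₁ x = 1 ↔ φ₂ (θ x) = 1` (the shape of abc-iut-L1-t7's
`hbase_of_pushCompat`) — the isomorphism `G₁ ⥲ G₂` over which `θ` lies EXISTS, is UNIQUE (`φ₂ ∘ θ = g ∘ φ₁`) and is a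
TOPOLOGICAL isomorphism: here `Gᵢ = Gal(ℚ̄_{pᵢ}/Kᵢ) = Im(φᵢ)` is carried as the fixing subgroup of `Kᵢ = ℚ̄_{pᵢ}^{Im Πᵢ}`
(`mem_fixingSubgroup_baseFld_iff`):
* `imMap θ` — `G₁ → G₂`, `φ₁(x) ↦ φ₂(θ x)` (well defined by `hkerθ`); a bijective group homomorphism;
* `imEquiv θ : ↥Gal(ℚ̄_{p₁}/K₁) ≃ₜ* ↥Gal(ℚ̄_{p₂}/K₂)` — continuity both ways because `φ₁ : Π₁ ↠ G₁` and
  `φ₂ ∘ θ : Π₁ ↠ G₂` are open continuous surjections, hence quotient maps (Mathlib `IsOpenMap.isQuotientMap`).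
Pure topological-group theory; nothing here concerns [IUTchIII]; no statement of the paper is strengthened (in print `θ` is
produced from `Ψ_Base` by [Mzk2] Prop. 3.2 — not formalised here; `θ`, `hkerθ` are named inputs).
-/

noncomputable section

namespace Literature.AlgebraicGeometry.Frobenioids

namespace PadicFrd

namespace RelGal

open Function Topology QuasiTemperoid

variable {p₁ p₂ : ℕ} [Fact p₁.Prime] [Fact p₂.Prime]
  {P₁ : Type} [Group P₁] [TopologicalSpace P₁] (φ₁ : P₁ →* GalFbar ℚ_[p₁]) (hφ₁ : IsOpenHom φ₁)
  {P₂ : Type} [Group P₂] [TopologicalSpace P₂] (φ₂ : P₂ →* GalFbar ℚ_[p₂]) (hφ₂ : IsOpenHom φ₂)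
  (θ : P₁ →* P₂) (hkerθ : ∀ x : P₁, φ₁ x = 1 ↔ φ₂ (θ x) = 1)

/-! ### `Πᵢ ↠ Gᵢ = Gal(ℚ̄_{pᵢ}/Kᵢ)` as a map into the subgroup -/

/-- `Π ↠ G = Im(Π) = Gal(ℚ̄_p/K)`, as a map into the subgroup. [cite: MochizukiFrdII2008, Def 2.2 p.17] -/
def toIm : P₁ → ↥(baseFld p₁ φ₁ hφ₁).fixingSubgroup := fun x => ⟨φ₁ x, map_mem_fixingSubgroup_baseFld p₁ φ₁ hφ₁ x⟩

/-- Values of `toIm`. [cite: MochizukiFrdII2008, Def 2.2 p.17] -/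
@[simp] theorem coe_toIm (x : P₁) : ((toIm φ₁ hφ₁ x : ↥(baseFld p₁ φ₁ hφ₁).fixingSubgroup) : GalFbar ℚ_[p₁]) = φ₁ x := rfl

/-- `toIm` is multiplicative. [cite: MochizukiFrdII2008, Def 2.2 p.17] -/
theorem toIm_mul (x y : P₁) : toIm φ₁ hφ₁ (x * y) = toIm φ₁ hφ₁ x * toIm φ₁ hφ₁ y := Subtype.ext (map_mul φ₁ x y)

/-- `Π ↠ G` is surjective. [cite: MochizukiFrdII2008, Def 2.2 p.17] -/
theorem toIm_surjective : Surjective (toIm φ₁ hφ₁) := by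
  rintro ⟨w, hw⟩
  obtain ⟨x, rfl⟩ := (mem_fixingSubgroup_baseFld_iff p₁ φ₁ hφ₁ w).mp hw
  exact ⟨x, rfl⟩

/-- `Π ↠ G` is continuous. [cite: MochizukiFrdII2008, Def 2.2 p.17] -/
theorem continuous_toIm : Continuous (toIm φ₁ hφ₁) := hφ₁.continuous.subtype_mk _

/-- `Π ↠ G` is an open map (`φ` is open and `G` carries the subspace topology). [cite: MochizukiFrdII2008, Def 2.2 p.17] -/
theorem isOpenMap_toIm : IsOpenMap (toIm φ₁ hφ₁) := by
  intro U hU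
  have hset : toIm φ₁ hφ₁ '' U = Subtype.val ⁻¹' (φ₁ '' U) := by
    ext ⟨w, hw⟩
    constructor
    · rintro ⟨x, hx, hxw⟩
      exact ⟨x, hx, congrArg Subtype.val hxw⟩
    · rintro ⟨x, hx, hxw⟩
      exact ⟨x, hx, Subtype.ext hxw⟩
  rw [hset]
  exact (hφ₁.isOpenMap U hU).preimage continuous_subtype_val

/-- Hence `Π ↠ G` is a quotient map. [cite: MochizukiFrdII2008, Def 2.2 p.17] -/
theorem isQuotientMap_toIm : IsQuotientMap (toIm φ₁ hφ₁) :=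
  (isOpenMap_toIm φ₁ hφ₁).isQuotientMap (continuous_toIm φ₁ hφ₁) (toIm_surjective φ₁ hφ₁)

/-! ### `G₁ ⥲ G₂`, `φ₁(x) ↦ φ₂(θ x)` -/

omit [TopologicalSpace P₁] [TopologicalSpace P₂] in
include hkerθ in
/-- Well-definedness: `φ₁ x = φ₁ y → φ₂(θ x) = φ₂(θ y)` (`θ` carries `Ker φ₁` into `Ker φ₂`). [cite: MochizukiFrdII2008, Thm 2.4 (i) p.19] -/
theorem map_theta_eq_of_map_eq {x y : P₁} (h : φ₁ x = φ₁ y) : φ₂ (θ x) = φ₂ (θ y) := by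
  have h1 : φ₁ (x⁻¹ * y) = 1 := by rw [map_mul, map_inv, h, inv_mul_cancel]
  have h2 : φ₂ (θ (x⁻¹ * y)) = 1 := (hkerθ _).mp h1
  rw [map_mul, map_mul, map_inv, map_inv, inv_mul_eq_one] at h2
  exact h2

omit [TopologicalSpace P₁] [TopologicalSpace P₂] in
include hkerθ in
/-- Injectivity: `φ₂(θ x) = φ₂(θ y) → φ₁ x = φ₁ y` (`θ` carries `Ker φ₂ ∩ Im θ` back into `Ker φ₁`).
[cite: MochizukiFrdII2008, Thm 2.4 (i) p.19] -/
theorem map_eq_of_map_theta_eq {x y : P₁} (h : φ₂ (θ x) = φ₂ (θ y)) : φ₁ x = φ₁ y := by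
  have h2 : φ₂ (θ (x⁻¹ * y)) = 1 := by rw [map_mul, map_mul, map_inv, map_inv, h, inv_mul_cancel]
  have h1 : φ₁ (x⁻¹ * y) = 1 := (hkerθ _).mpr h2
  rw [map_mul, map_inv, inv_mul_eq_one] at h1
  exact h1

/-- A representative in `Π₁` of an element of `G₁`. [cite: MochizukiFrdII2008, Def 2.2 p.17] -/
def rep (w : ↥(baseFld p₁ φ₁ hφ₁).fixingSubgroup) : P₁ :=
  ((mem_fixingSubgroup_baseFld_iff p₁ φ₁ hφ₁ w.1).mp w.2).choose

/-- `φ₁ (rep w) = w`. [cite: MochizukiFrdII2008, Def 2.2 p.17] -/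
theorem map_rep (w : ↥(baseFld p₁ φ₁ hφ₁).fixingSubgroup) : φ₁ (rep φ₁ hφ₁ w) = (w : GalFbar ℚ_[p₁]) :=
  ((mem_fixingSubgroup_baseFld_iff p₁ φ₁ hφ₁ w.1).mp w.2).choose_spec

/-- **`G₁ → G₂`, `φ₁(x) ↦ φ₂(θ x)`** — the homomorphism over which `θ` lies. [cite: MochizukiFrdII2008, Thm 2.4 (i) p.19] -/
def imMap : ↥(baseFld p₁ φ₁ hφ₁).fixingSubgroup → ↥(baseFld p₂ φ₂ hφ₂).fixingSubgroup :=
  fun w => toIm φ₂ hφ₂ (θ (rep φ₁ hφ₁ w))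

include hkerθ in
/-- `imMap (φ₁ x) = φ₂ (θ x)`: `φ₂ ∘ θ = imMap ∘ φ₁`. [cite: MochizukiFrdII2008, Thm 2.4 (i) p.19] -/
theorem imMap_toIm (x : P₁) : imMap φ₁ hφ₁ φ₂ hφ₂ θ (toIm φ₁ hφ₁ x) = toIm φ₂ hφ₂ (θ x) :=
  Subtype.ext (map_theta_eq_of_map_eq φ₁ φ₂ θ hkerθ (map_rep φ₁ hφ₁ (toIm φ₁ hφ₁ x)))

include hkerθ in
/-- Values: `↑(imMap w) = φ₂ (θ x)` for ANY `x` with `φ₁ x = w`. [cite: MochizukiFrdII2008, Thm 2.4 (i) p.19] -/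
theorem coe_imMap_of_eq (w : ↥(baseFld p₁ φ₁ hφ₁).fixingSubgroup) (x : P₁) (hx : φ₁ x = (w : GalFbar ℚ_[p₁])) :
    ((imMap φ₁ hφ₁ φ₂ hφ₂ θ w : ↥(baseFld p₂ φ₂ hφ₂).fixingSubgroup) : GalFbar ℚ_[p₂]) = φ₂ (θ x) := by
  have hw : w = toIm φ₁ hφ₁ x := Subtype.ext hx.symm
  rw [hw, imMap_toIm φ₁ hφ₁ φ₂ hφ₂ θ hkerθ]
  rfl

include hkerθ in
/-- `imMap` is multiplicative. [cite: MochizukiFrdII2008, Thm 2.4 (i) p.19] -/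
theorem imMap_mul (w w' : ↥(baseFld p₁ φ₁ hφ₁).fixingSubgroup) :
    imMap φ₁ hφ₁ φ₂ hφ₂ θ (w * w') = imMap φ₁ hφ₁ φ₂ hφ₂ θ w * imMap φ₁ hφ₁ φ₂ hφ₂ θ w' := by
  obtain ⟨x, rfl⟩ := toIm_surjective φ₁ hφ₁ w
  obtain ⟨y, rfl⟩ := toIm_surjective φ₁ hφ₁ w'
  rw [← toIm_mul, imMap_toIm φ₁ hφ₁ φ₂ hφ₂ θ hkerθ, imMap_toIm φ₁ hφ₁ φ₂ hφ₂ θ hkerθ,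
    imMap_toIm φ₁ hφ₁ φ₂ hφ₂ θ hkerθ, map_mul, toIm_mul]

include hkerθ in
/-- `imMap` is injective. [cite: MochizukiFrdII2008, Thm 2.4 (i) p.19] -/
theorem imMap_injective : Injective (imMap φ₁ hφ₁ φ₂ hφ₂ θ) := by
  intro w w' h
  obtain ⟨x, rfl⟩ := toIm_surjective φ₁ hφ₁ w
  obtain ⟨y, rfl⟩ := toIm_surjective φ₁ hφ₁ w'
  rw [imMap_toIm φ₁ hφ₁ φ₂ hφ₂ θ hkerθ, imMap_toIm φ₁ hφ₁ φ₂ hφ₂ θ hkerθ] at h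
  exact Subtype.ext (map_eq_of_map_theta_eq φ₁ φ₂ θ hkerθ (congrArg Subtype.val h))

include hkerθ in
/-- `imMap` is surjective when `θ` is. [cite: MochizukiFrdII2008, Thm 2.4 (i) p.19] -/
theorem imMap_surjective (hθs : Surjective θ) : Surjective (imMap φ₁ hφ₁ φ₂ hφ₂ θ) := by
  intro w₂
  obtain ⟨y, rfl⟩ := toIm_surjective φ₂ hφ₂ w₂
  obtain ⟨x, rfl⟩ := hθs y
  exact ⟨toIm φ₁ hφ₁ x, imMap_toIm φ₁ hφ₁ φ₂ hφ₂ θ hkerθ x⟩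

include hkerθ in
/-- `imMap` is continuous for `θ` continuous (`φ₁ : Π₁ ↠ G₁` is a quotient map and `imMap ∘ φ₁ = φ₂ ∘ θ`).
[cite: MochizukiFrdII2008, Thm 2.4 (i) p.19] -/
theorem continuous_imMap (hθc : Continuous θ) : Continuous (imMap φ₁ hφ₁ φ₂ hφ₂ θ) := by
  rw [(isQuotientMap_toIm φ₁ hφ₁).continuous_iff]
  have h : imMap φ₁ hφ₁ φ₂ hφ₂ θ ∘ toIm φ₁ hφ₁ = toIm φ₂ hφ₂ ∘ θ :=
    funext fun x => imMap_toIm φ₁ hφ₁ φ₂ hφ₂ θ hkerθ x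
  rw [h]
  exact (continuous_toIm φ₂ hφ₂).comp hθc

/-- **`G₁ ⥲ G₂` as a TOPOLOGICAL isomorphism** — the isomorphism over which a continuous open surjective `θ : Π₁ ↠ Π₂`
with `hkerθ` lies (its inverse is continuous because `φ₂ ∘ θ : Π₁ ↠ G₂` is a quotient map and `imMap⁻¹ ∘ (φ₂ ∘ θ) = φ₁`).
[cite: MochizukiFrdII2008, Thm 2.4 (i) p.19] -/
def imEquiv (hθc : Continuous θ) (hθo : IsOpenMap θ) (hθs : Surjective θ) :
    ↥(baseFld p₁ φ₁ hφ₁).fixingSubgroup ≃ₜ* ↥(baseFld p₂ φ₂ hφ₂).fixingSubgroup :=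
  let e : ↥(baseFld p₁ φ₁ hφ₁).fixingSubgroup ≃ ↥(baseFld p₂ φ₂ hφ₂).fixingSubgroup :=
    Equiv.ofBijective (imMap φ₁ hφ₁ φ₂ hφ₂ θ)
      ⟨imMap_injective φ₁ hφ₁ φ₂ hφ₂ θ hkerθ, imMap_surjective φ₁ hφ₁ φ₂ hφ₂ θ hkerθ hθs⟩
  have hq : IsQuotientMap (toIm φ₂ hφ₂ ∘ θ) :=
    ((isOpenMap_toIm φ₂ hφ₂).comp hθo).isQuotientMap ((continuous_toIm φ₂ hφ₂).comp hθc)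
      ((toIm_surjective φ₂ hφ₂).comp hθs)
  have hinv : Continuous e.symm := by
    rw [hq.continuous_iff]
    have h : e.symm ∘ (toIm φ₂ hφ₂ ∘ θ) = toIm φ₁ hφ₁ := by
      funext x
      apply e.injective
      rw [Function.comp_apply, Equiv.apply_symm_apply]
      exact (imMap_toIm φ₁ hφ₁ φ₂ hφ₂ θ hkerθ x).symm
    rw [h]
    exact continuous_toIm φ₁ hφ₁
  { e with
    map_mul' := imMap_mul φ₁ hφ₁ φ₂ hφ₂ θ hkerθ
    continuous_toFun := continuous_imMap φ₁ hφ₁ φ₂ hφ₂ θ hkerθ hθc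
    continuous_invFun := hinv }

/-- Values of `imEquiv`: `↑(imEquiv w) = φ₂ (θ x)` for any `x` with `φ₁ x = w`. [cite: MochizukiFrdII2008, Thm 2.4 (i) p.19] -/
theorem coe_imEquiv_of_eq (hθc : Continuous θ) (hθo : IsOpenMap θ) (hθs : Surjective θ)
    (w : ↥(baseFld p₁ φ₁ hφ₁).fixingSubgroup) (x : P₁) (hx : φ₁ x = (w : GalFbar ℚ_[p₁])) :
    ((imEquiv φ₁ hφ₁ φ₂ hφ₂ θ hkerθ hθc hθo hθs w : ↥(baseFld p₂ φ₂ hφ₂).fixingSubgroup) : GalFbar ℚ_[p₂]) = φ₂ (θ x) :=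
  coe_imMap_of_eq φ₁ hφ₁ φ₂ hφ₂ θ hkerθ w x hx

end RelGal

end PadicFrd

end Literature.AlgebraicGeometry.Frobenioids

end
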